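import Mathlib
import Summits.Ventures.HodgeRepro.Tier4.Line1.RTFSetting
import Summits.Ventures.HodgeRepro.Tier4.Line1.CentralVanishing

/-!
# Tier4/Line1/CentralVanishingSpectral — LINE L1: the central-character obstruction on the SPECTRAL side

Blind re-derivation cell `pub-hodge-repro`, Tier 4 «prove the step» (README §9–§10), seat t4-L1-p4 (gen 3; bus
S13375 / S13414).  Companion of `Tier4/Line1/CentralVanishing.lean` (p678622, the geometric side `J ≡ 0`); imports
ONLY Mathlib, the generic RTF layer `Tier4/Line1/RTFSetting.lean` and `CentralVanishing` (for the substitution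
`t ↦ zt` on `[T]`, `setIntegral_DT_central_mul` / `setIntegral_DT'_central_mul`).

WHAT IS PROVED.  The second sentence of the scope clause (Skeleton v0.27 → v0.33, docstring of `line1_realise`;
t4-plan-1 S12943 (1)): «on the spectral side every product `P_T(φ, χ) · conj P_{T′}(φ, χ′)` vanishes term by term
(a form `φ` with central character `ω` has `P_T(φ, χ) ≠ 0` only if `χ|_Z = ω` and `P_{T′}(φ, χ′) ≠ 0` only if
`χ′|_Z = ω`)» — in the kernel, on EVERY `RTF.Setting G`, for a left-`G(k)`-invariant `φ` that transforms under a
central `z ∈ Z` by a scalar `ω z` (`φ (z * x) = ω z * φ x`; nothing is assumed about `ω` beyond that):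

* **`periodT_eq_mul_of_central`** — `P_T(χ; φ) = ω(z) · conj χ(z) · P_T(χ; φ)` (the substitution `t ↦ zt` on `[T]`,
  with `φ(zt) = ω(z) φ(t)` and `χ(zt) = χ(z) χ(t)`); twin `periodT'_eq_mul_of_central` on `[T′]`;
* **`chi_eq_of_periodT_ne_zero`** — `P_T(χ; φ) ≠ 0 ⟹ χ(z) = ω(z)` (from `ω(z) conj χ(z) = 1` and `‖χ(z)‖ = 1`);
  twin `chi'_eq_of_periodT'_ne_zero`;
* **`centralMatch_of_periods_ne_zero`** — both toric periods non-zero on vectors with the SAME central scalars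
  `ω` ⟹ `χ = χ′` on the centre (N2): the spectral-side twin of `centralMatch_of_J_ne_zero`;
* **`periodT'_mul_conj_periodT_eq_zero_of_ne_on_centre`** — when `χ(z) ≠ χ′(z)` for one `z ∈ Z`, the product
  `P_{T′}(χ′; ψ) · conj P_T(χ; φ)` of the spectral expansion vanishes for every pair of vectors with common central
  scalars — the «term by term» sentence.

No instance is built; `[Countable S.Gk]` is the only extra instance; no integrability is assumed anywhere.  Nothing
here says anything about the status of the Hodge conjecture for CM abelian varieties, which is NOT proved (HC_CM is
NOT proved by anyone in this repository).
-/

set_option autoImplicit false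

noncomputable section

namespace Summit.Ventures.HodgeRepro.Tier4.Line1

open MeasureTheory Topology

namespace RTF

variable {G : Type} [Group G] [TopologicalSpace G] [IsTopologicalGroup G] [MeasurableSpace G]
  [BorelSpace G]

namespace Setting

variable (S : Setting G)

/-- **The toric period transforms under the centre**: for a left-`G(k)`-invariant `φ` with `φ(zx) = ω φ(x)`,
`P_T(χ; φ|_T) = ω · conj χ(z) · P_T(χ; φ|_T)` — the substitution `t ↦ zt` on `[T]`. -/
theorem periodT_eq_mul_of_central [Countable S.Gk] {χ : S.T → ℂ} (hχ : S.IsCharacter χ) {z : G}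
    (hz : z ∈ S.Z) {φ : G → ℂ} (hφ : S.Invariant φ) {ω : ℂ} (hω : ∀ x, φ (z * x) = ω * φ x) :
    S.periodT χ (fun t => φ t) =
      ω * starRingEnd ℂ (χ ⟨z, S.ZleT hz⟩) * S.periodT χ (fun t => φ t) := by
  set zT : S.T := ⟨z, S.ZleT hz⟩ with hzT
  unfold periodT
  have hsub : ∫ t in S.DT, φ t * starRingEnd ℂ (χ t) ∂S.μT =
      ∫ t in S.DT, φ (zT * t) * starRingEnd ℂ (χ (zT * t)) ∂S.μT := by
    refine (S.setIntegral_DT_central_mul hz (fun t : S.T => φ t * starRingEnd ℂ (χ t)) ?_).symm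
    intro g t
    have hg : ((g : S.T) : G) ∈ S.Gk := Subgroup.mem_subgroupOf.mp g.2
    have hφg : φ ((g • t : S.T) : G) = φ t := by
      rw [Subgroup.smul_def, smul_eq_mul, Subgroup.coe_mul]
      exact hφ ⟨_, hg⟩ t
    have hχg : χ (g • t) = χ t := by
      rw [Subgroup.smul_def, smul_eq_mul, hχ.map_mul, hχ.rational _ g.2, one_mul]
    simp only [hφg, hχg]
  have hterm : ∀ t : S.T, φ (zT * t) * starRingEnd ℂ (χ (zT * t)) =
      ω * starRingEnd ℂ (χ zT) * (φ t * starRingEnd ℂ (χ t)) := by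
    intro t
    have h1 : φ ((zT : G) * t) = ω * φ t := hω t
    rw [h1, hχ.map_mul, map_mul]
    ring
  calc ∫ t in S.DT, φ t * starRingEnd ℂ (χ t) ∂S.μT
      = ∫ t in S.DT, φ (zT * t) * starRingEnd ℂ (χ (zT * t)) ∂S.μT := hsub
    _ = ω * starRingEnd ℂ (χ zT) * ∫ t in S.DT, φ t * starRingEnd ℂ (χ t) ∂S.μT := by
        simp only [hterm, integral_const_mul]

/-- **The second toric period transforms under the centre** (twin of `periodT_eq_mul_of_central`). -/
theorem periodT'_eq_mul_of_central [Countable S.Gk] {χ' : S.T' → ℂ} (hχ' : S.IsCharacter' χ') {z : G}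
    (hz : z ∈ S.Z) {φ : G → ℂ} (hφ : S.Invariant φ) {ω : ℂ} (hω : ∀ x, φ (z * x) = ω * φ x) :
    S.periodT' χ' (fun t' => φ t') =
      ω * starRingEnd ℂ (χ' ⟨z, S.ZleT' hz⟩) * S.periodT' χ' (fun t' => φ t') := by
  set zT' : S.T' := ⟨z, S.ZleT' hz⟩ with hzT'
  unfold periodT'
  have hsub : ∫ t' in S.DT', φ t' * starRingEnd ℂ (χ' t') ∂S.μT' =
      ∫ t' in S.DT', φ (zT' * t') * starRingEnd ℂ (χ' (zT' * t')) ∂S.μT' := by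
    refine (S.setIntegral_DT'_central_mul hz (fun t' : S.T' => φ t' * starRingEnd ℂ (χ' t')) ?_).symm
    intro g t'
    have hg : ((g : S.T') : G) ∈ S.Gk := Subgroup.mem_subgroupOf.mp g.2
    have hφg : φ ((g • t' : S.T') : G) = φ t' := by
      rw [Subgroup.smul_def, smul_eq_mul, Subgroup.coe_mul]
      exact hφ ⟨_, hg⟩ t'
    have hχg : χ' (g • t') = χ' t' := by
      rw [Subgroup.smul_def, smul_eq_mul, hχ'.map_mul, hχ'.rational _ g.2, one_mul]
    simp only [hφg, hχg]
  have hterm : ∀ t' : S.T', φ (zT' * t') * starRingEnd ℂ (χ' (zT' * t')) =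
      ω * starRingEnd ℂ (χ' zT') * (φ t' * starRingEnd ℂ (χ' t')) := by
    intro t'
    have h1 : φ ((zT' : G) * t') = ω * φ t' := hω t'
    rw [h1, hχ'.map_mul, map_mul]
    ring
  calc ∫ t' in S.DT', φ t' * starRingEnd ℂ (χ' t') ∂S.μT'
      = ∫ t' in S.DT', φ (zT' * t') * starRingEnd ℂ (χ' (zT' * t')) ∂S.μT' := hsub
    _ = ω * starRingEnd ℂ (χ' zT') * ∫ t' in S.DT', φ t' * starRingEnd ℂ (χ' t') ∂S.μT' := by
        simp only [hterm, integral_const_mul]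

/-- A unit-modulus `u` with `ω · conj u = 1` equals `ω`. -/
theorem eq_of_mul_conj_eq_one {u ω : ℂ} (hu : ‖u‖ = 1) (h : ω * starRingEnd ℂ u = 1) : u = ω := by
  have hunit : u * starRingEnd ℂ u = 1 := by
    rw [Complex.mul_conj, Complex.normSq_eq_norm_sq, hu]
    simp
  calc u = u * (ω * starRingEnd ℂ u) := by rw [h, mul_one]
    _ = ω * (u * starRingEnd ℂ u) := by ring
    _ = ω := by rw [hunit, mul_one]

/-- **A non-zero toric period pins the character on the centre to the central scalar**: `P_T(χ; φ) ≠ 0 ⟹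
`χ(z) = ω`. -/
theorem chi_eq_of_periodT_ne_zero [Countable S.Gk] {χ : S.T → ℂ} (hχ : S.IsCharacter χ) {z : G}
    (hz : z ∈ S.Z) {φ : G → ℂ} (hφ : S.Invariant φ) {ω : ℂ} (hω : ∀ x, φ (z * x) = ω * φ x)
    (hP : S.periodT χ (fun t => φ t) ≠ 0) : χ ⟨z, S.ZleT hz⟩ = ω := by
  have h := S.periodT_eq_mul_of_central hχ hz hφ hω
  have h0 : (1 - ω * starRingEnd ℂ (χ ⟨z, S.ZleT hz⟩)) * S.periodT χ (fun t => φ t) = 0 := by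
    rw [sub_mul, one_mul, ← h, sub_self]
  rcases mul_eq_zero.mp h0 with h1 | h1
  · exact eq_of_mul_conj_eq_one (hχ.unit _) (sub_eq_zero.mp h1).symm
  · exact absurd h1 hP

/-- **A non-zero second toric period pins `χ′` on the centre to the central scalar** (twin). -/
theorem chi'_eq_of_periodT'_ne_zero [Countable S.Gk] {χ' : S.T' → ℂ} (hχ' : S.IsCharacter' χ') {z : G}
    (hz : z ∈ S.Z) {φ : G → ℂ} (hφ : S.Invariant φ) {ω : ℂ} (hω : ∀ x, φ (z * x) = ω * φ x)
    (hP : S.periodT' χ' (fun t' => φ t') ≠ 0) : χ' ⟨z, S.ZleT' hz⟩ = ω := by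
  have h := S.periodT'_eq_mul_of_central hχ' hz hφ hω
  have h0 : (1 - ω * starRingEnd ℂ (χ' ⟨z, S.ZleT' hz⟩)) * S.periodT' χ' (fun t' => φ t') = 0 := by
    rw [sub_mul, one_mul, ← h, sub_self]
  rcases mul_eq_zero.mp h0 with h1 | h1
  · exact eq_of_mul_conj_eq_one (hχ'.unit _) (sub_eq_zero.mp h1).symm
  · exact absurd h1 hP

/-- **Both toric periods non-zero on vectors with the same central scalars force N2**: if `φ` and `ψ` are
left-`G(k)`-invariant with `φ(zx) = ω(z) φ(x)` and `ψ(zx) = ω(z) ψ(x)` for every `z ∈ Z`, and `P_T(χ; φ) ≠ 0`,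
`P_{T′}(χ′; ψ) ≠ 0`, then `χ = χ′` on the centre (`CentralMatch χ χ′`). -/
theorem centralMatch_of_periods_ne_zero [Countable S.Gk] {χ : S.T → ℂ} {χ' : S.T' → ℂ}
    (hχ : S.IsCharacter χ) (hχ' : S.IsCharacter' χ') {φ ψ : G → ℂ} (hφ : S.Invariant φ)
    (hψ : S.Invariant ψ) {ω : G → ℂ} (hωφ : ∀ z ∈ S.Z, ∀ x, φ (z * x) = ω z * φ x)
    (hωψ : ∀ z ∈ S.Z, ∀ x, ψ (z * x) = ω z * ψ x) (hP : S.periodT χ (fun t => φ t) ≠ 0)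
    (hP' : S.periodT' χ' (fun t' => ψ t') ≠ 0) : S.CentralMatch χ χ' := by
  intro z hz
  rw [S.chi_eq_of_periodT_ne_zero hχ hz hφ (hωφ z hz) hP,
    S.chi'_eq_of_periodT'_ne_zero hχ' hz hψ (hωψ z hz) hP']

/-- **Term-by-term vanishing of the spectral expansion off N2**: if `χ(z) ≠ χ′(z)` for one `z ∈ Z`, then for every
pair of left-`G(k)`-invariant vectors with the same central scalars the spectral term
`P_{T′}(χ′; ψ) · conj P_T(χ; φ)` is zero. -/
theorem periodT'_mul_conj_periodT_eq_zero_of_ne_on_centre [Countable S.Gk] {χ : S.T → ℂ}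
    {χ' : S.T' → ℂ} (hχ : S.IsCharacter χ) (hχ' : S.IsCharacter' χ') {z : G} (hz : z ∈ S.Z)
    (hne : χ ⟨z, S.ZleT hz⟩ ≠ χ' ⟨z, S.ZleT' hz⟩) {φ ψ : G → ℂ} (hφ : S.Invariant φ)
    (hψ : S.Invariant ψ) {ω : ℂ} (hωφ : ∀ x, φ (z * x) = ω * φ x) (hωψ : ∀ x, ψ (z * x) = ω * ψ x) :
    S.periodT' χ' (fun t' => ψ t') * starRingEnd ℂ (S.periodT χ (fun t => φ t)) = 0 := by
  by_contra hcon
  apply hne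
  have hP : S.periodT χ (fun t => φ t) ≠ 0 := by
    intro h0
    apply hcon
    rw [h0, map_zero, mul_zero]
  have hP' : S.periodT' χ' (fun t' => ψ t') ≠ 0 := by
    intro h0
    apply hcon
    rw [h0, zero_mul]
  rw [S.chi_eq_of_periodT_ne_zero hχ hz hφ hωφ hP, S.chi'_eq_of_periodT'_ne_zero hχ' hz hψ hωψ hP']

end Setting

end RTF

end Summit.Ventures.HodgeRepro.Tier4.Line1

end
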